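import Summits.Ventures.YMGap.Census.TwistCensusObjects
import HarnessLib

/-!
# Venture YMGap, track (b) census — the KINK MODEL objects: the one-character top moment as an integer vertex sum

HONEST FRAMING: venture file of the cell `pub-ymgap` (QuantumFields programme), seat engine-1 (g14).  This file DEFINES
the finite "kink" vertex model of `HOME/engine/census/LadderSkew/AllOdd/kink/KINK-MODEL.md` — integer site weights
`4·T ∈ {129, 9, 1, −3, −27}`, link weights `6·w ∈ {1, 3}`, the integer kink sum `kinkSumInt Ls` and its normalisation
`kinkSum Ls = kinkSumInt Ls / 864^{#sites}` — and proves the table facts by `decide`.  The identity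
`rectCharMoment Ls univ = kinkSum Ls` (derived on paper in KINK-MODEL.md §2 from the `U(2)` Weingarten formula, each link
being degree-balanced, and verified against every exact top moment of record) is NOT proved here; it is typed as
`Conjectures.KinkIdentity` in `Conjectures/KinkIdentity.lean` for a successor to discharge (ingredients in the tree:
`Census/SU2QuarticMoment`, `Census/SU2DecoratedMerging`, `Census/RectTimeSlicing`).  Nothing about the Wilson action,
limits, confinement or a mass gap; `Conjectures.TwistCensusParity` is not imported and keeps its status.

THE MODEL.  Links of the 3-torus `Π_i ℤ/(Ls i)` carry a label `σ ∈ Bool` (`false` = "+", `6w = 1`; `true` = "−", `6w = 3`).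
At a site `x` the six link ends are read in the order (+x out, −x in, +y out, −y in, +z out, −z in), "+i out" = the link
`(x, i)`, "−i in" = the link `(x − eᵢ, i)`.  Per axis the (in, out) pair is of type `E` (equal labels; value = the label) or
`D` (a KINK; orientation = the out-label, read with a sign twist on the `y` axis coming from the plaquette orientation
`U_p = U(x,i) U(x+eᵢ,j) U(x+eⱼ,i)⁻¹ U(x,j)⁻¹`, `i < j`, of `rectPlaquetteHolonomy`).  With `k` = number of kinked axes,
`4T` is: `k = 0`: `129` (all "+"), `1` (all "−"), `9` otherwise · `k = 1`: `−3` if the two unkinked values agree, else `9` ·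
`k = 2`: `9` if the two kinks are aligned, else `−3` · `k = 3`: `−27` if all three aligned, else `−3`.

References: B. Collins, P. Śniady, Comm. Math. Phys. 264 (2006) 773–795 (Weingarten calculus); M. Creutz, *Quarks, gluons
and lattices* (CUP 1983) ch. 8; cell file KINK-MODEL.md (derivation §2, validation §3, structure §4, kit data §7).
-/

namespace Summit.Ventures.YMGap.Census

open Literature.MathematicalPhysics.QuantumLattice

namespace KinkModel

/-- Six times the link weight of a kink label: `6·w(+) = 1` (`false`), `6·w(−) = 3` (`true`). -/
def linkWeight6 (b : Bool) : ℤ := if b then 3 else 1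

/-- Four times the site weight of the kink model, as a function of the six link-end labels
`e = (+x out, −x in, +y out, −y in, +z out, −z in)` (`false` = "+"), by the KINK RULE of the module docstring. -/
def site4 (e : Fin 6 → Bool) : ℤ :=
  let kx := (e 0 != e 1)
  let ky := (e 2 != e 3)
  let kz := (e 4 != e 5)
  -- kink orientations (`true` = "positive"); the `y` axis carries the orientation-convention twist
  let dx := (e 0 == false)
  let dy := (e 2 == true)
  let dz := (e 4 == false)
  match kx, ky, kz with
  | false, false, false =>
      if (e 0 == false) && (e 2 == false) && (e 4 == false) then 129
      else if (e 0 == true) && (e 2 == true) && (e 4 == true) then 1 else 9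
  | true, false, false => if e 2 == e 4 then -3 else 9
  | false, true, false => if e 0 == e 4 then -3 else 9
  | false, false, true => if e 0 == e 2 then -3 else 9
  | true, true, false => if dx == dy then 9 else -3
  | true, false, true => if dx == dz then 9 else -3
  | false, true, true => if dy == dz then 9 else -3
  | true, true, true => if (dx == dy) && (dy == dz) then -27 else -3

/-- `4T` takes exactly the five values `129, 9, 1, −3, −27`. -/
theorem site4_mem (e : Fin 6 → Bool) :
    site4 e = 129 ∨ site4 e = 9 ∨ site4 e = 1 ∨ site4 e = -3 ∨ site4 e = -27 := by
  revert e; decide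

/-- Sign census of the 64 site weights: exactly 32 are negative … -/
theorem card_site4_neg : (Finset.univ.filter fun e : Fin 6 → Bool => site4 e < 0).card = 32 := by decide

/-- … of which 30 equal `−3` and 2 equal `−27` (the two fully kinked, aligned patterns = the local form of the staggered
"A/B" configurations); 30 equal `9`, one equals `129` (all "+") and one equals `1` (all "−"). -/
theorem card_site4_values :
    (Finset.univ.filter fun e : Fin 6 → Bool => site4 e = -27).card = 2 ∧
    (Finset.univ.filter fun e : Fin 6 → Bool => site4 e = -3).card = 30 ∧
    (Finset.univ.filter fun e : Fin 6 → Bool => site4 e = 9).card = 30 ∧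
    (Finset.univ.filter fun e : Fin 6 → Bool => site4 e = 129).card = 1 ∧
    (Finset.univ.filter fun e : Fin 6 → Bool => site4 e = 1).card = 1 := by
  refine ⟨by decide, by decide, by decide, by decide, by decide⟩

/-- `Σ_e 4T(e) = 256`: by the Hadamard form `T(e) = 2⁻³ Σ_σ (−1)^{⟨e,σ⟩} 2^{#cycles(σ)}` of KINK-MODEL §2 the sum over
`e` keeps only the all-planar pairing pattern, `Σ_e T(e) = 8 · 2³ = 64` (while `8·T(+,…,+) = Σ_σ 2^{#cycles(σ)} = 258`). -/
theorem sum_site4 : ∑ e : Fin 6 → Bool, site4 e = 256 := by decide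

/-- Spot values of `4T` transcribed from the cell's exact table `T_planar_pm.json` (KINK-MODEL §1): the two `−27` patterns,
three of the four `DDD`/`EDD`/`EED` sign alternatives, and the three uniform `EEE` patterns — a check that the rule above (with its
`y`-axis orientation twist) is the table. -/
theorem site4_spot :
    site4 ![false, true, true, false, false, true] = -27 ∧ site4 ![true, false, false, true, true, false] = -27 ∧
    site4 ![false, true, false, true, false, true] = -3 ∧ site4 ![false, true, false, false, false, false] = -3 ∧
    site4 ![false, true, false, false, true, true] = 9 ∧ site4 ![false, true, true, false, false, false] = 9 ∧
    site4 ![false, true, false, true, false, false] = -3 ∧ site4 ![false, true, false, false, false, true] = 9 ∧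
    site4 ![false, true, false, false, true, false] = -3 ∧ site4 ![false, false, false, true, false, true] = -3 ∧
    site4 ![false, false, false, true, true, false] = 9 ∧ site4 ![false, false, false, false, false, false] = 129 ∧
    site4 ![true, true, true, true, true, true] = 1 ∧ site4 ![false, false, false, false, true, true] = 9 := by
  decide

variable (Ls : Fin 3 → ℕ) [∀ i, NeZero (Ls i)]

/-- The six link-end labels at a site `x`, in the order (+x out, −x in, +y out, −y in, +z out, −z in):
out = the link `(x, i)`, in = the link `(x − eᵢ, i)`. -/
def endLabels (σ : RectEdge Ls → Bool) (x : RectTorusSite Ls) : Fin 6 → Bool :=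
  ![σ (x, 0), σ (x - Pi.single 0 1, 0), σ (x, 1), σ (x - Pi.single 1 1, 1), σ (x, 2), σ (x - Pi.single 2 1, 2)]

/-- **The integer kink sum** `N(Λ) = Σ_σ (∏_links 6w(σ_ℓ)) · ∏_sites 4T(σ|ₓ)` over all labelings `σ : links → Bool`. -/
def kinkSumInt : ℤ :=
  ∑ σ : RectEdge Ls → Bool, (∏ l : RectEdge Ls, linkWeight6 (σ l)) * ∏ x : RectTorusSite Ls, site4 (endLabels Ls σ x)

/-- **The kink sum** `kinkSum Ls = N(Λ) / 864^{#sites}` (`864 = 4 · 6³`: one factor `4` per site and `6` per link, three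
links per site). -/
noncomputable def kinkSum : ℝ :=
  (kinkSumInt Ls : ℝ) / (864 : ℝ) ^ Fintype.card (RectTorusSite Ls)

end KinkModel

end Summit.Ventures.YMGap.Census
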